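import Summits.ResolutionOfSingularities.ResolutionOfSingularities.Theorems.HilbertSamuelEliminationSigmaMaxModificationsCorridor3CPFrameNearOrder
import Summits.ResolutionOfSingularities.ResolutionOfSingularities.Theorems.HilbertSamuelEliminationSigmaMaxModificationsCorridor3WLadderCPFrameLocalChart
import Summits.ResolutionOfSingularities.ResolutionOfSingularities.Theorems.HilbertSamuelEliminationSigmaMaxModificationsCorridor3CPFrameNearShape
import Literature.AlgebraicGeometry.Resolution.RegularLocalRingsProofs
import Mathlib.RingTheory.RegularLocalRing.Polynomial
import Mathlib.RingTheory.Localization.LocalizationLocalization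
import HarnessLib

/-!
# [OURS · L1 W4.2] D18 G5 (i): the HYPERSURFACE READING of a CP-frame ring and of a chart local ring — both are quotients of regular
# local rings of polynomial type by one equation, in the shape consumed by `mem_pow_of_hilbertFun_quotient_eq` (G4)
# (cell res-hironaka, LADDER-RESOLUTION rung L; slot W4.2, crux chain w42 `SigmaMaxModificationsCorridor3` stmt-ResolutionOfSingularities-19249;
# `--supports stmt-ResolutionOfSingularities-19249 --as helper`; hand res-D-brk-3 (gen 6), cut G5 of TAKING 13:03:41Z; G1–G4 = p534278,
# p536675, p537948, p538976)

PURE COMMUTATIVE ALGEBRA, 0 `def`s, every declaration PROVED; OURS bookkeeping; NOT a statement of Hironaka's manuscript [Hironaka2017] nor of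
[CossartJannsenSaito2020]/[CossartPiltant2019]. AI-written, weaker than expert review.

* `exists_isLocalRing_adjoinRoot_of_coeff_mem` — a CP-frame ring `R[X]/(h)` (`R` local, `h` monic of degree `m ≥ 1`, lower coefficients in
  `𝔪_R`) is LOCAL with maximal ideal `𝔪_R R[X]/(h) + (x)` (res-D-pv-050's `isLocalRing_adjoinRoot_of_fibre` at `θ = 0`).
* `comap_C_comap_mk_maximalIdeal` — the maximal ideal `𝔐` of `R[X]` above it contracts to `𝔪_R`.
* **`exists_frame_hypersurface_reading`** — for `R` REGULAR local and `coeff_i h ∈ 𝔪_R^{m-i}` (`δ ≥ 1`): `R[X]_𝔐` is a regular local ring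
  (Mathlib `Polynomial.isRegularLocalRing_localization_atPrime_of_comap_eq_maximalIdeal`), `h ≠ 0` there, `h ∈ 𝔪_{R[X]_𝔐}^m`, and
  `R[X]/(h) ≅ R[X]_𝔐/(h)` (G4 `exists_ringEquiv_quotient_localization_of_isLocalRing`), so the Hilbert functions and dimensions agree.
* **`exists_chart_hypersurface_reading`** — for a Noetherian domain `S`, `h' ∈ S[X]` monic and a prime `𝔔₃` of `S[X]/(h')` with preimage
  `𝔔₃'` in `S[X]` such that `S_𝔮` is regular local (`𝔮 = 𝔔₃' ∩ S`): `S[X]_{𝔔₃'}` is REGULAR local (it is `S_𝔮[X]_{𝔔₃'S_𝔮[X]}`, a localisation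
  of a localisation, regular by the Mathlib lemma over the local base `S_𝔮`), `h' ≠ 0` and `h' ∈ 𝔪` there, and
  `(S[X]/(h'))_{𝔔₃} ≅ S[X]_{𝔔₃'}/(h')` (G4 `exists_ringEquiv_localization_quotient`), so Hilbert functions and dimensions agree — the `S₂`-side
  input of G4; its output `h' ∈ 𝔪^m` is NearShape's order hypothesis at `𝔔₃'` (p529392 `exists_frame_translate_localization_of_order`).
* **`exists_mul_mem_pow_of_hilbertFun_eq`** — NEAR ⇒ ORDER end to end: if `(S[X]/(h'))_{𝔔₃}` has the Hilbert function and dimension of the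
  CP-frame ring `R[X]/(h)` (`δ ≥ 1`), then `s·h' ∈ 𝔔₃'^m` for some `s ∉ 𝔔₃'` (`m = deg h`).

References: CJS LNM 2270 §2.2 [CossartJannsenSaito2020]; Matsumura §14, Thm. 19.5 [Matsumura1987]; tree G4 `…CPFrameNearOrder`, 050's
`…WLadderCPFrameLocalChart`.
-/

noncomputable section

set_option linter.dupNamespace false

open IsLocalRing IsLocalization Polynomial
open Literature.RingTheory.HilbertSamuel Literature.AlgebraicGeometry.Resolution
open Summit.ResolutionOfSingularities.ResolutionOfSingularities.Theorems.SigmaMaxModificationsCorridor3.Moving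

universe u

namespace Summit.ResolutionOfSingularities.ResolutionOfSingularities.Theorems.SigmaMaxModificationsCorridor3.Helpers

/-! ## The CP-frame ring `R[X]/(h)` -/

section Frame

variable {R : Type u} [CommRing R] [IsLocalRing R] {h : R[X]}

/-- A CP-frame ring `R[X]/(h)` — `h` monic of degree `m ≥ 1` with lower coefficients in `𝔪_R` — is LOCAL, with maximal ideal
`𝔪_R·R[X]/(h) + (x)`. [folklore] -/
theorem exists_isLocalRing_adjoinRoot_of_coeff_mem (hmo : h.Monic) (hm : 0 < h.natDegree)
    (hco : ∀ i < h.natDegree, h.coeff i ∈ maximalIdeal R) :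
    ∃ _ : IsLocalRing (AdjoinRoot h),
      maximalIdeal (AdjoinRoot h) = (maximalIdeal R).map (AdjoinRoot.of h) ⊔ Ideal.span {AdjoinRoot.root h} := by
  obtain ⟨hloc, hmax⟩ := isLocalRing_adjoinRoot_of_fibre hmo hm 0 (fun i hi => by
    rw [map_zero, add_zero, comp_X]; exact hco i hi)
  refine ⟨hloc, ?_⟩
  rw [hmax, map_zero, sub_zero]

variable [IsLocalRing (AdjoinRoot h)]

/-- The maximal ideal `𝔐` of `R[X]` over the maximal ideal of the local ring `R[X]/(h)` (`h` monic) contracts to `𝔪_R` — the extension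
`R → R[X]/(h)` is integral. [folklore] -/
theorem comap_C_comap_mk_maximalIdeal (hmo : h.Monic) :
    ((maximalIdeal (AdjoinRoot h)).comap (AdjoinRoot.mk h)).comap C = maximalIdeal R := by
  haveI : Module.Finite R (AdjoinRoot h) := hmo.finite_adjoinRoot
  rw [Ideal.comap_comap]
  change (maximalIdeal (AdjoinRoot h)).comap (algebraMap R (AdjoinRoot h)) = maximalIdeal R
  exact eq_maximalIdeal (Ideal.isMaximal_comap_of_isIntegral_of_isMaximal (R := R) (maximalIdeal (AdjoinRoot h)))

/-- `X ∈ 𝔐` and `𝔪_R ⊆ 𝔐 ∩ R` when the lower coefficients of `h` lie in `𝔪_R`. [folklore] -/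
theorem X_mem_comap_mk_maximalIdeal (hmo : h.Monic) (hm : 0 < h.natDegree) (hco : ∀ i < h.natDegree, h.coeff i ∈ maximalIdeal R) :
    (X : R[X]) ∈ (maximalIdeal (AdjoinRoot h)).comap (AdjoinRoot.mk h) := by
  obtain ⟨hloc', hmax⟩ := exists_isLocalRing_adjoinRoot_of_coeff_mem hmo hm hco
  have hmax' : maximalIdeal (AdjoinRoot h) = (maximalIdeal R).map (AdjoinRoot.of h) ⊔ Ideal.span {AdjoinRoot.root h} := hmax
  rw [Ideal.mem_comap, hmax']
  exact Ideal.mem_sup_right (Ideal.subset_span rfl)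

end Frame

section FrameRegular

variable {R : Type u} [CommRing R] [IsRegularLocalRing R] {h : R[X]} [IsLocalRing (AdjoinRoot h)]

/-- [OURS · L1 W4.2] **The hypersurface reading of a CP-frame ring.** `R` regular local, `h ∈ R[X]` monic of degree `m ≥ 1` with
`coeff_i h ∈ 𝔪_R^{m-i}` (`δ ≥ 1`), `R[X]/(h)` local (automatic, `exists_isLocalRing_adjoinRoot_of_coeff_mem`). With `𝔐 ⊂ R[X]` the maximal
ideal above: `R[X]_𝔐` is REGULAR local, `h ≠ 0` in it, `h ∈ 𝔪_{R[X]_𝔐}^m`, `R[X]_𝔐/(h)` is local and has the Hilbert function and the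
dimension of `R[X]/(h)` (indeed `R[X]/(h) ≅ R[X]_𝔐/(h)`). [cite: Matsumura1987, Thm. 19.5] -/
theorem exists_frame_hypersurface_reading (hmo : h.Monic) (hm : 0 < h.natDegree)
    (hco : ∀ i < h.natDegree, h.coeff i ∈ maximalIdeal R ^ (h.natDegree - i)) :
    ∃ (_ : ((maximalIdeal (AdjoinRoot h)).comap (AdjoinRoot.mk h)).IsPrime)
      (_ : IsRegularLocalRing (Localization.AtPrime ((maximalIdeal (AdjoinRoot h)).comap (AdjoinRoot.mk h))))
      (_ : IsLocalRing (Localization.AtPrime ((maximalIdeal (AdjoinRoot h)).comap (AdjoinRoot.mk h)) ⧸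
        Ideal.span {algebraMap R[X] (Localization.AtPrime ((maximalIdeal (AdjoinRoot h)).comap (AdjoinRoot.mk h))) h})),
      algebraMap R[X] (Localization.AtPrime ((maximalIdeal (AdjoinRoot h)).comap (AdjoinRoot.mk h))) h ≠ 0 ∧
      algebraMap R[X] (Localization.AtPrime ((maximalIdeal (AdjoinRoot h)).comap (AdjoinRoot.mk h))) h ∈
        maximalIdeal (Localization.AtPrime ((maximalIdeal (AdjoinRoot h)).comap (AdjoinRoot.mk h))) ^ h.natDegree ∧
      hilbertFun (AdjoinRoot h) =
        hilbertFun (Localization.AtPrime ((maximalIdeal (AdjoinRoot h)).comap (AdjoinRoot.mk h)) ⧸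
          Ideal.span {algebraMap R[X] (Localization.AtPrime ((maximalIdeal (AdjoinRoot h)).comap (AdjoinRoot.mk h))) h}) ∧
      ringKrullDim (AdjoinRoot h) =
        ringKrullDim (Localization.AtPrime ((maximalIdeal (AdjoinRoot h)).comap (AdjoinRoot.mk h)) ⧸
          Ideal.span {algebraMap R[X] (Localization.AtPrime ((maximalIdeal (AdjoinRoot h)).comap (AdjoinRoot.mk h))) h}) := by
  set 𝔐 : Ideal R[X] := (maximalIdeal (AdjoinRoot h)).comap (AdjoinRoot.mk h) with h𝔐
  haveI h𝔐p : 𝔐.IsPrime := Ideal.comap_isPrime _ _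
  have hcomapC : 𝔐.comap C = maximalIdeal R := comap_C_comap_mk_maximalIdeal hmo
  haveI hreg : IsRegularLocalRing (Localization.AtPrime 𝔐) :=
    Polynomial.isRegularLocalRing_localization_atPrime_of_comap_eq_maximalIdeal R 𝔐 hcomapC
  haveI : IsDomain R := isDomain_of_isRegularLocalRing R
  -- `h ≠ 0` in the localisation
  have hinj : Function.Injective (algebraMap R[X] (Localization.AtPrime 𝔐)) :=
    IsLocalization.injective (Localization.AtPrime 𝔐) 𝔐.primeCompl_le_nonZeroDivisors
  have hne : algebraMap R[X] (Localization.AtPrime 𝔐) h ≠ 0 := fun h0 =>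
    hmo.ne_zero (hinj (by rw [h0, map_zero]))
  -- `h ∈ 𝔐^m`
  have hXmem : (X : R[X]) ∈ 𝔐 :=
    X_mem_comap_mk_maximalIdeal hmo hm (fun i hi => Ideal.pow_le_self (by omega) (hco i hi))
  have hCmem : ∀ {r : R} {k : ℕ}, r ∈ maximalIdeal R ^ k → C r ∈ 𝔐 ^ k := fun {r k} hr => by
    have h1 : C r ∈ (maximalIdeal R ^ k).map (C : R →+* R[X]) := Ideal.mem_map_of_mem _ hr
    rw [Ideal.map_pow] at h1
    refine Ideal.pow_right_mono ?_ k h1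
    rw [Ideal.map_le_iff_le_comap, hcomapC]
  have key : X ^ h.natDegree + ∑ i ∈ Finset.range h.natDegree, C (h.coeff i) * X ^ i ∈ 𝔐 ^ h.natDegree := by
    refine add_mem (Ideal.pow_mem_pow hXmem _) (Ideal.sum_mem _ fun i hi => ?_)
    have hi' : i < h.natDegree := Finset.mem_range.mp hi
    have h1 : C (h.coeff i) * X ^ i ∈ 𝔐 ^ (h.natDegree - i) * 𝔐 ^ i :=
      Ideal.mul_mem_mul (hCmem (hco i hi')) (Ideal.pow_mem_pow hXmem i)
    rwa [← pow_add, Nat.sub_add_cancel hi'.le] at h1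
  have hh𝔐 : h ∈ 𝔐 ^ h.natDegree := by
    have h2 := key
    rwa [← hmo.as_sum] at h2
  have hhpow : algebraMap R[X] (Localization.AtPrime 𝔐) h ∈ maximalIdeal (Localization.AtPrime 𝔐) ^ h.natDegree := by
    rw [← Localization.AtPrime.map_eq_maximalIdeal, ← Ideal.map_pow]
    exact Ideal.mem_map_of_mem _ hh𝔐
  -- the isomorphism `R[X]/(h) ≅ R[X]_𝔐/(h)`
  haveI : IsLocalRing (R[X] ⧸ Ideal.span {h}) := ‹IsLocalRing (AdjoinRoot h)›
  obtain ⟨e, -⟩ := exists_ringEquiv_quotient_localization_of_isLocalRing (R := R[X]) (Ideal.span {h})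
  have e0 : AdjoinRoot h ≃+* Localization.AtPrime 𝔐 ⧸ (Ideal.span {h}).map (algebraMap R[X] (Localization.AtPrime 𝔐)) := e
  have hspan : (Ideal.span {h}).map (algebraMap R[X] (Localization.AtPrime 𝔐)) =
      Ideal.span {algebraMap R[X] (Localization.AtPrime 𝔐) h} := by
    rw [Ideal.map_span, Set.image_singleton]
  let e' : AdjoinRoot h ≃+* Localization.AtPrime 𝔐 ⧸ Ideal.span {algebraMap R[X] (Localization.AtPrime 𝔐) h} :=
    e0.trans (Ideal.quotEquivOfEq hspan)
  haveI hloc' : IsLocalRing (Localization.AtPrime 𝔐 ⧸ Ideal.span {algebraMap R[X] (Localization.AtPrime 𝔐) h}) := e'.isLocalRing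
  haveI : IsNoetherianRing (AdjoinRoot h) := inferInstance
  exact ⟨h𝔐p, hreg, hloc', hne, hhpow, hilbertFun_eq_of_ringEquiv e', ringKrullDim_eq_of_ringEquiv e'⟩

end FrameRegular

/-! ## The chart local ring `(S[X]/(h'))_{𝔔₃}` -/

section Chart

variable {S : Type u} [CommRing S] [IsDomain S] [IsNoetherianRing S] {g : S[X]}

/-- [OURS · L1 W4.2] **The hypersurface reading of a chart local ring.** `S` a Noetherian domain, `g ∈ S[X]` monic, `𝔔₃` a prime of
`S[X]/(g)` with preimage `𝔔₃'` in `S[X]` and `𝔮 = 𝔔₃' ∩ S` such that `S_𝔮` is REGULAR local. With `𝔔₄ = 𝔔₃'·S_𝔮[X]`: `𝔔₄` is a prime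
contracting to `𝔔₃'`, containing `𝔪_{S_𝔮}` (under `C`) and `g`; `S_𝔮[X]_{𝔔₄}` is regular local; `g ≠ 0` there; and
`(S[X]/(g))_{𝔔₃} ≅ S_𝔮[X]_{𝔔₄}/(g)`, so Hilbert functions and dimensions agree. [cite: Matsumura1987, Thm. 19.5] -/
theorem exists_chart_hypersurface_reading (hmo : g.Monic) (𝔔₃ : Ideal (AdjoinRoot g)) [𝔔₃.IsPrime]
    (hreg : IsRegularLocalRing (Localization.AtPrime (((𝔔₃.comap (AdjoinRoot.mk g)).comap C)))) :
    ∃ (_ : IsRegularLocalRing (Localization.AtPrime (𝔔₃.comap (AdjoinRoot.mk g))))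
      (_ : IsLocalRing (Localization.AtPrime (𝔔₃.comap (AdjoinRoot.mk g)) ⧸
        Ideal.span {algebraMap S[X] (Localization.AtPrime (𝔔₃.comap (AdjoinRoot.mk g))) g})),
      algebraMap S[X] (Localization.AtPrime (𝔔₃.comap (AdjoinRoot.mk g))) g ≠ 0 ∧
      algebraMap S[X] (Localization.AtPrime (𝔔₃.comap (AdjoinRoot.mk g))) g ∈
        maximalIdeal (Localization.AtPrime (𝔔₃.comap (AdjoinRoot.mk g))) ∧
      hilbertFun (Localization.AtPrime 𝔔₃) = hilbertFun (Localization.AtPrime (𝔔₃.comap (AdjoinRoot.mk g)) ⧸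
        Ideal.span {algebraMap S[X] (Localization.AtPrime (𝔔₃.comap (AdjoinRoot.mk g))) g}) ∧
      ringKrullDim (Localization.AtPrime 𝔔₃) = ringKrullDim (Localization.AtPrime (𝔔₃.comap (AdjoinRoot.mk g)) ⧸
        Ideal.span {algebraMap S[X] (Localization.AtPrime (𝔔₃.comap (AdjoinRoot.mk g))) g}) := by
  set 𝔔₃' : Ideal S[X] := 𝔔₃.comap (AdjoinRoot.mk g) with h𝔔₃'
  set q : Ideal S := 𝔔₃'.comap C with hq
  haveI : 𝔔₃'.IsPrime := Ideal.comap_isPrime _ _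
  haveI : q.IsPrime := Ideal.comap_isPrime _ _
  -- `S[X] → S_𝔮[X]` is the localisation at `C(S ∖ 𝔮)`
  letI : Algebra S[X] (Localization.AtPrime q)[X] := Polynomial.algebra S (Localization.AtPrime q)
  haveI : IsLocalization (q.primeCompl.map (C : S →+* S[X])) (Localization.AtPrime q)[X] :=
    Polynomial.isLocalization q.primeCompl (Localization.AtPrime q)
  have halg : algebraMap S[X] (Localization.AtPrime q)[X] = mapRingHom (algebraMap S (Localization.AtPrime q)) := rfl
  have hdisj : Disjoint ((q.primeCompl.map (C : S →+* S[X]) : Submonoid S[X]) : Set S[X]) (𝔔₃' : Set S[X]) := by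
    refine Set.disjoint_left.mpr ?_
    rintro _ ⟨s, hs, rfl⟩ hmem
    exact hs (Ideal.mem_comap.mpr hmem)
  set 𝔔₄ : Ideal (Localization.AtPrime q)[X] := 𝔔₃'.map (mapRingHom (algebraMap S (Localization.AtPrime q))) with h𝔔₄
  haveI h𝔔₄p : 𝔔₄.IsPrime :=
    IsLocalization.isPrime_of_isPrime_disjoint (q.primeCompl.map (C : S →+* S[X])) (Localization.AtPrime q)[X] 𝔔₃'
      ‹𝔔₃'.IsPrime› hdisj
  have hcomap : 𝔔₄.comap (mapRingHom (algebraMap S (Localization.AtPrime q))) = 𝔔₃' := by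
    have h1 := IsLocalization.under_map_of_isPrime_disjoint (q.primeCompl.map (C : S →+* S[X]))
      (Localization.AtPrime q)[X] ‹𝔔₃'.IsPrime› hdisj
    rwa [Ideal.under_def, halg] at h1
  -- `𝔔₄ ∩ S_𝔮 = 𝔪_{S_𝔮}`, so `S_𝔮[X]_{𝔔₄}` is regular local
  have hle : maximalIdeal (Localization.AtPrime q) ≤ 𝔔₄.comap C := by
    rw [← Localization.AtPrime.map_eq_maximalIdeal, Ideal.map_le_iff_le_comap.symm, Ideal.map_map,
      ← Polynomial.mapRingHom_comp_C, ← Ideal.map_map]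
    exact Ideal.map_mono (Ideal.map_le_iff_le_comap.mpr le_rfl)
  have hcomapC : 𝔔₄.comap C = maximalIdeal (Localization.AtPrime q) :=
    ((maximalIdeal.isMaximal _).eq_of_le (Ideal.comap_ne_top _ h𝔔₄p.ne_top) hle).symm
  haveI hreg₄ : IsRegularLocalRing (Localization.AtPrime 𝔔₄) :=
    Polynomial.isRegularLocalRing_localization_atPrime_of_comap_eq_maximalIdeal (Localization.AtPrime q) 𝔔₄ hcomapC
  -- `S[X]_{𝔔₃'} ≅ S_𝔮[X]_{𝔔₄}` over `S[X]`, hence regular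
  haveI : IsScalarTower S[X] (Localization.AtPrime q)[X] (Localization.AtPrime 𝔔₄) := IsScalarTower.of_algebraMap_eq' rfl
  have hM : (𝔔₄.comap (algebraMap S[X] (Localization.AtPrime q)[X])).primeCompl = 𝔔₃'.primeCompl := by
    ext x
    rw [Ideal.mem_primeCompl_iff, Ideal.mem_primeCompl_iff, halg, hcomap]
  have hloc₂ : IsLocalization.AtPrime (Localization.AtPrime 𝔔₄) 𝔔₃' := by
    have h := IsLocalization.isLocalization_isLocalization_atPrime_isLocalization (q.primeCompl.map (C : S →+* S[X]))
      (T := Localization.AtPrime 𝔔₄) 𝔔₄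
    change IsLocalization _ _ at h
    change IsLocalization _ _
    rwa [hM] at h
  let e₂ : Localization.AtPrime 𝔔₃' ≃ₐ[S[X]] Localization.AtPrime 𝔔₄ :=
    @IsLocalization.algEquiv S[X] _ 𝔔₃'.primeCompl (Localization.AtPrime 𝔔₃') _ _ _ _ _ _ hloc₂
  haveI hreg₃ : IsRegularLocalRing (Localization.AtPrime 𝔔₃') :=
    IsRegularLocalRing.of_ringEquiv (R := Localization.AtPrime 𝔔₄) (R' := Localization.AtPrime 𝔔₃') e₂.symm.toRingEquiv
  -- `g ∈ 𝔔₃'`, so `g ∈ 𝔪` and `g ≠ 0` in `S[X]_{𝔔₃'}`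
  have hg3 : g ∈ 𝔔₃' := by
    rw [h𝔔₃', Ideal.mem_comap, AdjoinRoot.mk_self]
    exact zero_mem _
  have hgmax : algebraMap S[X] (Localization.AtPrime 𝔔₃') g ∈ maximalIdeal (Localization.AtPrime 𝔔₃') := by
    rw [← Localization.AtPrime.map_eq_maximalIdeal]
    exact Ideal.mem_map_of_mem _ hg3
  have hinj : Function.Injective (algebraMap S[X] (Localization.AtPrime 𝔔₃')) :=
    IsLocalization.injective (Localization.AtPrime 𝔔₃') 𝔔₃'.primeCompl_le_nonZeroDivisors
  have hne : algebraMap S[X] (Localization.AtPrime 𝔔₃') g ≠ 0 := fun h0 => hmo.ne_zero (hinj (by rw [h0, map_zero]))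
  -- `(S[X]/(g))_{𝔔₃} ≅ S[X]_{𝔔₃'}/(g)`
  obtain ⟨e₁, -⟩ := @exists_ringEquiv_localization_quotient S[X] _ (Ideal.span {g}) 𝔔₃ (by exact ‹𝔔₃.IsPrime›)
  have e0 : Localization.AtPrime 𝔔₃ ≃+* Localization.AtPrime 𝔔₃' ⧸ (Ideal.span {g}).map (algebraMap S[X] (Localization.AtPrime 𝔔₃')) :=
    e₁
  have hspan : (Ideal.span {g}).map (algebraMap S[X] (Localization.AtPrime 𝔔₃')) =
      Ideal.span {algebraMap S[X] (Localization.AtPrime 𝔔₃') g} := by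
    rw [Ideal.map_span, Set.image_singleton]
  let e : Localization.AtPrime 𝔔₃ ≃+* Localization.AtPrime 𝔔₃' ⧸ Ideal.span {algebraMap S[X] (Localization.AtPrime 𝔔₃') g} :=
    e0.trans (Ideal.quotEquivOfEq hspan)
  haveI hloc' : IsLocalRing (Localization.AtPrime 𝔔₃' ⧸ Ideal.span {algebraMap S[X] (Localization.AtPrime 𝔔₃') g}) :=
    e.isLocalRing
  haveI : IsNoetherianRing (AdjoinRoot g) := inferInstance
  haveI : IsNoetherianRing (Localization.AtPrime 𝔔₃) := IsLocalization.isNoetherianRing 𝔔₃.primeCompl _ inferInstance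
  exact ⟨hreg₃, hloc', hne, hgmax, hilbertFun_eq_of_ringEquiv e, ringKrullDim_eq_of_ringEquiv e⟩

end Chart

/-! ## Near ⇒ order, end to end -/

section NearOrder

variable {R : Type u} [CommRing R] [IsRegularLocalRing R] {h : R[X]} [IsLocalRing (AdjoinRoot h)]
variable {S : Type u} [CommRing S] [IsDomain S] [IsNoetherianRing S] {g : S[X]}

/-- [OURS · L1 W4.2] **NEAR ⇒ ORDER, end to end.** `(R, h)` a CP frame with `δ ≥ 1` (`coeff_i h ∈ 𝔪_R^{m-i}`), `g ∈ S[X]` monic over a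
Noetherian domain `S`, `𝔔₃` a prime of `S[X]/(g)` with `S_𝔮` regular local (`𝔮 = 𝔔₃ ∩ S`). If the local ring `(S[X]/(g))_{𝔔₃}` has the
Hilbert function and the dimension of `R[X]/(h)` — the situation at a NEAR point of the blow-up of a CP-frame hypersurface, by the flat
presentations and the constancy of `H^{(0)}` along a canonical near step — then `g` has ORDER `≥ m = deg h` at the preimage `𝔔₃'` of `𝔔₃`:
`s · g ∈ 𝔔₃'^m` for some `s ∉ 𝔔₃'`, the hypothesis `hord` of p529392 `exists_frame_translate_localization_of_order`.
[cite: CossartJannsenSaito2020, Thm. 2.3, §2.2] -/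
theorem exists_mul_mem_pow_of_hilbertFun_eq (hmo : h.Monic) (hm : 0 < h.natDegree)
    (hco : ∀ i < h.natDegree, h.coeff i ∈ maximalIdeal R ^ (h.natDegree - i))
    (hgmo : g.Monic) (𝔔₃ : Ideal (AdjoinRoot g)) [𝔔₃.IsPrime]
    (hreg : IsRegularLocalRing (Localization.AtPrime (((𝔔₃.comap (AdjoinRoot.mk g)).comap C))))
    (hH : hilbertFun (Localization.AtPrime 𝔔₃) = hilbertFun (AdjoinRoot h))
    (hdim : ringKrullDim (Localization.AtPrime 𝔔₃) = ringKrullDim (AdjoinRoot h)) :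
    ∃ s ∉ 𝔔₃.comap (AdjoinRoot.mk g), s * g ∈ (𝔔₃.comap (AdjoinRoot.mk g)) ^ h.natDegree := by
  obtain ⟨_, hreg₁, hloc₁, hne₁, hpow₁, hH₁, hdim₁⟩ := exists_frame_hypersurface_reading hmo hm hco
  obtain ⟨hreg₂, hloc₂, hne₂, hmax₂, hH₂, hdim₂⟩ := exists_chart_hypersurface_reading hgmo 𝔔₃ hreg
  haveI := hreg₁
  haveI := hloc₁
  haveI := hreg₂
  haveI := hloc₂
  have hmem := mem_pow_of_hilbertFun_quotient_eq_of_ringKrullDim_quotient_eq hne₁ (Ideal.pow_le_self (by omega) hpow₁) hpow₁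
    hne₂ hmax₂ (hdim₁.symm.trans (hdim.symm.trans hdim₂)) (hH₁.symm.trans (hH.symm.trans hH₂))
  exact exists_mul_mem_pow_of_algebraMap_mem_pow hmem

end NearOrder

end Summit.ResolutionOfSingularities.ResolutionOfSingularities.Theorems.SigmaMaxModificationsCorridor3.Helpers

end
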